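import Mathlib
import Summits.Ventures.HodgeRepro2.T6NDatum
import Summits.Ventures.HodgeRepro2.T6N1Datum
import Summits.Ventures.HodgeRepro2.T6N3Datum
import Summits.Ventures.HodgeRepro2.T6N41Datum
import Summits.Ventures.HodgeRepro2.T6N42Main
import Summits.Ventures.HodgeRepro2.T6N43Lfac
import Summits.Ventures.HodgeRepro2.T6N5Skeleton

/-!
# T6NAut — the automorphic datum `NAut F P` of the M2 composition (TARGET-T6 v0.4 §9.2(b))

Cell pub-hodge-repro2, Tier 6 (README §10), seat t6-lead (gen 2). `NAut F P` is the ONE carrier the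
six owners' main theorems are written against (`*_main (P : NDatum F) (M : NAut F P) …`, §9.3): it
bundles the owners' datum types AS FILED AND ACCEPTED — t6-p3's `N3Datum` (π₀, π₀′, the tori, the
τ′-vectors, ℓ_A, ℓ_B; p401070), t6-p1's `N1Datum` (p401228), t6-p4's `DoublingLDatum` (p401010),
t6-p5's `N42Datum.FinitePlacesDatum` (p401079, with `Place` / `ThetaNonzeroAt` of p401271), t6-p6's
`N43Places` (p401381, with `withLfac` of p401466; over `ArchDoublingDatum`, p400729) and t6-p7's
`N5Skeleton.N5Data` (p400858) — together with the DICTIONARY between them: the choice map `data` (the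
Schwartz data of a choice `c`), the parameter shape of N1 (`FA c = F_A(φ_a, φ_b)`,
`FB c = F_B(φ_c, φ_d)`, t6-p1's PARAMETER SHAPE, STATUS l. 4833),
and the COMPAT fields (§9.2(b): «a field of `NAut`, docstring-tagged `[compat: owners i,j; discharged
at: Layer III | residual IR]`»). Every compat field identifies ONE object of the record carried twice
(the same place, the same non-vanishing statement in two owners' vocabularies; the archimedean
`L`-factors are identified by construction through `N43Places.withLfac`); no field asserts a printed
theorem — the print-side bridges between the owners' conclusions (the
Rallis inner product formula (R1) ∧ (H_loc) ⇒ (i), GQT Prop. 35(i) at the archimedean places, the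
(P7) placement `hunr`) are DISPLAY / RESIDUAL BINDERS of the owners' mains and of the composition
`periodInputN_of_published` (§9.2(c) «(displays…) [residuals]»), never fields.

The six Props of Proposition N* are DEFINED over this vocabulary (`NAut.iA := M.d3.A.hypI`, …,
never opaque), and `NAut.pairing c = ⟪F_B c, F_A c⟫_ℂ` is N1's pairing
in N3's vocabulary.

v1 SCOPE: the N2 datum of t6-p2 is not yet filed; `AdmDatum` (N2's conclusion: μ-admissibility of the
four `ε_i`, `W_A ≅ W_B`, (H_χ)) is therefore NOT part of v1 — v2 adds `d2` and `AdmDatum` over it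
(append-only: every v1 projection keeps its name and type).

§8(d): uses an L-value-free non-vanishing device: NO.
-/

namespace Summit.Ventures.HodgeRepro2.T6

open scoped InnerProductSpace

variable {K : Type*} [Field K] [NumberField K]

/-- ONE SIDE of N4 (side A: `π₀` on `W₁₂ = W_A`; side B: `π₀′` on `W₃₄ = W_B`): the finite-place
datum of N4.2, the three archimedean doubling data of N4.3 (one bundle `N43Places` for the three real
places `τ′₁, τ′₂, τ′₃` of `F⁺`), the doubling-L datum of N4.1 indexed by ALL places
`d42.Place ⊕ Fin 3` (finite on the left, the real place `j` as `Sum.inr j`), and the identification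
of the local-theta Props at the finite places (the archimedean `L`-factors are identified by
construction, `NSide.ArchNonvanishing`). -/
structure NSide where
  /-- the N4.2 datum: the finite places of `F⁺` (split / non-split in `E`) with the local dual pairs,
  the Witt towers and the zeta data (t6-p5, `T6N42Datum`) -/
  d42 : N42Datum.FinitePlacesDatum
  /-- the N4.3 data at the three real places of `F⁺` (t6-p6, `T6N43Places`): `d₁` at the compact
  place `τ′₁` (`H₁ = U(2)` with its probability Haar measure), `d₂`, `d₃` at `τ′₂`, `τ′₃`
  (`H = U(1,1)`), with the Eischen–Liu weight parameters of the archimedean `L`-factors -/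
  d43 : N43Places
  /-- the N4.1 datum over all places of `F⁺`: the doubling `L`-function `L(s, π₀ × χ_V)`, its local
  factors, the two auxiliary Hecke `L`-functions and the local theta-lift Props (t6-p4, `T6N41Datum`) -/
  d41 : DoublingLDatum (d42.Place ⊕ Fin 3)
  /-- `[compat: owners t6-p4, t6-p5; discharged at: residual IR]` the same statement «the local theta
  lift of `π₀,v` to `U(V_v)` is non-zero» at a finite place `v`, in N4.1's words (`d41.thetaNonzero`)
  and in N4.2's (`Hom_{G_v}(ω_v, π₀,v) ≠ 0` at a split place, first occurrence at index 1 at a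
  non-split place: `FinitePlacesDatum.ThetaNonzeroAt`) -/
  theta_fin : ∀ v : d42.Place, d41.thetaNonzero (Sum.inl v) ↔ d42.ThetaNonzeroAt v

namespace NSide

variable (s : NSide)

/-- the places of `F⁺` as the index type of N4.1: the finite places of the N4.2 datum and the three
real places -/
abbrev Place : Type := s.d42.Place ⊕ Fin 3

/-- N4.3's conclusion at all three real places, `Z^*_{τ′_j}(½) ≠ 0` for `j = 0, 1, 2`, with the
archimedean `L`-factors of the N4.3 bundle IDENTIFIED BY CONSTRUCTION with N4.1's local factors
`d41.Lv (Sum.inr j)` (t6-p6's `N43Places.withLfac`, `T6N43Lfac` p401466: the three `Lfac` fields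
re-pointed, nothing else touched — so no compat field is needed for the identification). This is the
conclusion of `N43Places.N43_places_withLfac s.d43 (fun j => s.d41.Lv (Sum.inr j)) …`, whose
Eischen–Liu binders are stated directly on `d41.Lv (Sum.inr j)`. -/
abbrev ArchNonvanishing : Prop :=
  (s.d43.withLfac fun j => s.d41.Lv (Sum.inr j)).ArchNonvanishing

/-- N4's conclusion for this side in N4.1's words: (R1) `L(s, π₀ × χ_V)` is holomorphic and non-zero
at `s = 1`, and (H_loc) the local theta lift is non-zero at every place. -/
def R1AndHloc : Prop := s.d41.R1 ∧ s.d41.Hloc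

/-- (H_loc) at the finite places is N4.2's `ThetaNonzeroEverywhere`, through `theta_fin`. -/
theorem hloc_fin_iff :
    (∀ v : s.d42.Place, s.d41.thetaNonzero (Sum.inl v)) ↔ s.d42.ThetaNonzeroEverywhere := by
  rw [N42Datum.FinitePlacesDatum.thetaNonzeroEverywhere_iff]
  exact forall_congr' s.theta_fin

/-- `Hloc` splits into its finite and archimedean halves (the shape of N4's (H_loc) =
`N42_main ∧ N43_main`, TARGET-T6 v0.4 §9.4 (q3)). -/
theorem hloc_iff :
    s.d41.Hloc ↔ s.d42.ThetaNonzeroEverywhere ∧ ∀ j : Fin 3, s.d41.thetaNonzero (Sum.inr j) := by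
  rw [← s.hloc_fin_iff]
  unfold DoublingLDatum.Hloc
  exact Sum.forall

end NSide

/-- THE AUTOMORPHIC DATUM of the M2 composition over the period datum `P` (TARGET-T6 v0.4 §9.2(b)):
the N3 datum (the automorphic spaces, `π₀`, `π₀′`, the Schwartz spaces, the theta lifts, the toric
periods), the choice dictionary `data` (the Schwartz data `(φ_a, φ_b, φ_c, φ_d)` of a choice `c` of the
period datum), the N1 datum in N3's parameter shape, the two N4 sides, the N5 datum, and the compat
identifications. -/
structure NAut (F : FaceSetting K) (P : NDatum F) where
  /-- the N3 datum (t6-p3, `T6N3Datum`): `L²([G])`, `G(𝔸_f)`, the two sides `A` (`W₁₂`, `π₀`, `T₁₂`,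
  `χ₁₂`) and `B` (`W₃₄`, `π₀′`, `T₃₄`, `χ₃₄`) with their Schwartz spaces, theta lifts and toric periods -/
  d3 : N3Datum
  /-- the Schwartz data of a choice `c` of the period datum: `(φ_a, φ_b)` on side A and `(φ_c, φ_d)`
  on side B (t6-p3's choice dictionary, STATUS l. 4764 (3)) -/
  data : P.Choice → d3.A.Sa × d3.A.Sb × d3.B.Sa × d3.B.Sb
  /-- `[compat: owners t6-lead, t6-p3; discharged at: residual IR]` every quadruple of Schwartz data
  is realised by an admissible choice -/
  data_surj : ∀ (φa : d3.A.Sa) (φb : d3.A.Sb) (φc : d3.B.Sa) (φd : d3.B.Sb),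
    ∃ c, P.AdmChoice c ∧ data c = (φa, φb, φc, φd)
  /-- the N1 datum (t6-p1, `T6N1Datum`) in N3's parameter shape: `LG = L²([G])`,
  `F_A c = F_A(φ_a, φ_b) = η_a η_b`, `F_B c = F_B(φ_c, φ_d) = η_{c̄} η_{d̄}` at the Schwartz data of `c` -/
  d1 : N1Datum F P d3.LG (fun c => d3.A.F (data c).1 (data c).2.1)
    (fun c => d3.B.F (data c).2.2.1 (data c).2.2.2)
  /-- the N4 data of side A (`π₀` on `W_A = W₁₂`) -/
  sA : NSide
  /-- the N4 data of side B (`π₀′` on `W_B = W₃₄`) -/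
  sB : NSide
  /-- the index type of the toric data of N5 -/
  ι5 : Type
  /-- the (abelian) torus of N5 -/
  G5 : Type
  [instG5 : CommGroup G5]
  /-- the N5 datum (t6-p7, `T6N5Skeleton`): the two toric sides with the same `β` and the same
  splitting character `f` -/
  d5 : N5Skeleton.N5Data ι5 G5
  /-- `[compat: owners t6-p3, t6-p7; discharged at: residual IR]` N5's conclusion on side A («the
  toric period `P_{χ₁₂}` is not identically zero on the level part», `ToricSide.levelPeriodNonzero`)
  is Proposition N*'s hypothesis (ii) for side A in N3's words (`N3Side.hypII`) -/
  hypII_A_of_N5 : d5.A.levelPeriodNonzero → d3.A.hypII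
  /-- `[compat: owners t6-p3, t6-p7; discharged at: residual IR]` the same on side B -/
  hypII_B_of_N5 : d5.B.levelPeriodNonzero → d3.B.hypII

namespace NAut

variable {F : FaceSetting K} {P : NDatum F} (M : NAut F P)

/-- the group structure of the N5 torus (field) -/
instance : CommGroup M.G5 := M.instG5

/-- Proposition N*'s hypothesis (i) for side A: the global theta lift `Θ(f, φ)` of `π₀` to `U(V)` is
non-zero on a `τ′`-isotypic vector (`N3Side.hypI`). -/
def iA : Prop := M.d3.A.hypI

/-- (i) for side B. -/
def iB : Prop := M.d3.B.hypI

/-- Proposition N*'s hypothesis (ii) for side A: the toric period `P_{χ₁₂}` is not identically zero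
on the level part of the `π₀`-isotypic component (`N3Side.hypII`). -/
def iiA : Prop := M.d3.A.hypII

/-- (ii) for side B. -/
def iiB : Prop := M.d3.B.hypII

/-- Proposition N*'s conclusion for side A: `ℓ_A ≠ 0` (`N3Datum.ellNonzero`). -/
def ellA : Prop := M.d3.ellNonzero M.d3.A

/-- Proposition N*'s conclusion for side B: `ℓ_B ≠ 0`. -/
def ellB : Prop := M.d3.ellNonzero M.d3.B

/-- N1's pairing `⟨F_A, F_B⟩ = ∫_{[G]} F_A \overline{F_B}` at the choice `c`, in N3's vocabulary
(Mathlib's `⟪x, y⟫_ℂ` is conjugate-linear in `x`: the record's `⟨a, b⟩` is `⟪b, a⟫_ℂ`). -/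
noncomputable def pairing (c : P.Choice) : ℂ :=
  ⟪M.d3.B.F (M.data c).2.2.1 (M.data c).2.2.2, M.d3.A.F (M.data c).1 (M.data c).2.1⟫_ℂ

/-- `NAut.pairing` is the N1 datum's pairing. -/
theorem pairing_eq (c : P.Choice) : M.pairing c = M.d1.pairing c := rfl

/-- The isotypic step of N3 in the choice form: if some Schwartz data `(φ_a, φ_b, φ_c, φ_d)` have a
non-zero pairing `⟨F_A(φ_a, φ_b), F_B(φ_c, φ_d)⟩` (t6-p3's `N3iso_of_datum`), then some admissible
choice `c` of the period datum has `pairing c ≠ 0` — through the compat field `data_surj`. -/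
theorem exists_choice_of_pairing_ne_zero
    (h : ∃ (φa : M.d3.A.Sa) (φb : M.d3.A.Sb) (φc : M.d3.B.Sa) (φd : M.d3.B.Sb),
      ⟪M.d3.B.F φc φd, M.d3.A.F φa φb⟫_ℂ ≠ 0) :
    ∃ c, P.AdmChoice c ∧ M.pairing c ≠ 0 := by
  obtain ⟨φa, φb, φc, φd, hne⟩ := h
  obtain ⟨c, hc, hdata⟩ := M.data_surj φa φb φc φd
  refine ⟨c, hc, ?_⟩
  unfold pairing
  rw [hdata]
  exact hne

/-- N4's conclusion for both sides in N4.1's words. -/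
def N4 : Prop := M.sA.R1AndHloc ∧ M.sB.R1AndHloc

/-- N5's conclusion (t6-p7's `N5Data.N5`): both toric periods are non-zero on the level parts. -/
def N5 : Prop := M.d5.N5

/-- N5 gives Proposition N*'s hypotheses (ii) on both sides, through the compat fields. -/
theorem iiA_and_iiB_of_N5 (h : M.N5) : M.iiA ∧ M.iiB :=
  ⟨M.hypII_A_of_N5 h.1, M.hypII_B_of_N5 h.2⟩

end NAut

end Summit.Ventures.HodgeRepro2.T6
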